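/-
Copyright (c) 2026. All rights reserved.
Released under Apache 2.0 license as described in the file LICENSE.
-/
import Mathlib
import HarnessLib
import Literature.MathematicalPhysics.QuantumLattice.GaugeGroups
import Literature.MathematicalPhysics.QuantumFieldTheory.ConstructiveQFTWave0
import Literature.MathematicalPhysics.QuantumFieldTheory.LatticeGaugeProofs
import Literature.MathematicalPhysics.QuantumLattice.AbelianFieldTensor
import Literature.MathematicalPhysics.QuantumLattice.AbelianMagneticFlux
import Summits.Ventures.LatticeQCDFlow.Scaling.FluxSectorCollar
import Summits.Ventures.LatticeQCDFlow.Scaling.RowFields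
import Summits.Ventures.LatticeQCDFlow.Scaling.FluxInsertionKernel
import Summits.Ventures.LatticeQCDFlow.Scaling.SectorActionFloor

/-!
# The mountain-pass inequality for flux-insertion kernels, generic form (lean-1 GEN-6, own work;
the lower-bound half of conjecture C9″b of THEORY-2.md)

HONEST FRAMING: exact (Metropolis-corrected) sampling algorithms for lattice gauge theory;
figures of merit are autocorrelation/cost numbers at stated couplings and volumes; no
continuum-physics claim.

Venture `LatticeQCDFlow` (cell pub-lqcd), topic `Scaling`, FANOUT row 30 (lean-1).  NEW WORK of the
cell; nothing here is cited as a fact.  `d = 2`, compact `U(1)`, torus `(ℤ/L)²`, plaquette angles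
`F(x) ∈ (−π, π]`, `S = Σ_x (1 − cos F(x))`, `Q = Σ_x F(x)/(2π)` (Lüscher's flux charge).

**Setting.**  An insertion `W` whose plaquette field is `e^{iα}` on a set `R` of `N` positions and
`1` elsewhere, with `Nα = 2π` (one unit of flux), `N ≥ 5`, and `N ≤ M := #Rᶜ = L² − N`.

**Theorem** (`sharpValue_le_max_wilsonAction_of_exp`): for EVERY configuration `U` with
`Q(WU) ≠ Q(U)`,  `max(S(U), S(WU)) ≥ N(1 − cos(α/2)) + M(1 − cos(π/M))`  — pointwise, not only
almost everywhere.  Proof: the jump decomposition `F_{WU} = F_U + α·1_R + 2πm`, `m ∈ {0, −1}`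
(`exists_jump_mul`), gives `Q(WU) − Q(U) = 1 + Σ m ≠ 0` (`topCharge_mul_eq_of_jumps`); either
some plaquette jumps — then at least two do and `S(U) ≥ 2(1 + cos α) ≥ N(1 − cos(π/N)) +
M(1 − cos(π/M))` (`one_add_cos_le_of_jump_mul`, `sharpValue_le_jumpPrice_real`) — or none does,
and the full-range tangent bounds of `1 − cos` (`SectorActionFloor`) at `α/2 = π/N` on `R` (for
`WU` and, reflected, for `U`) and at `π/M` off `R`, the flux quantisation `Σ_R F + Σ_{Rᶜ} F ∈ 2πℤ`
and `sin(π/M) ≤ sin(π/N)` close the estimate (`mountainPass_arith`).  Instances: the block spread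
(`FluxInsertionBlockPasses`) and the line twist (`FluxInsertionLineHeightValue`).  No `def`.
-/

noncomputable section

open MeasureTheory Filter Topology Real Set
open scoped ENNReal
open Literature.MathematicalPhysics.QuantumFieldTheory Literature.MathematicalPhysics.QuantumLattice
open Summit.Ventures.LatticeQCDFlow.Exactness

namespace Summit.Ventures.LatticeQCDFlow.Theory2.Lattice.Flux

/-! ## §1 Pure real bookkeeping -/

section Arith

/-- **The conjectured value never exceeds the jump price**: for `n ≥ 5`, `m ≥ 4`,
`n(1 − cos(π/n)) + m(1 − cos(π/m)) ≤ 2(1 + cos(2π/n))`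
(`lhs ≤ π²/10 + π²/8`, `rhs ≥ 4 − (2π/n)² ≥ 4 − 4π²/25`). [folklore] -/
theorem sharpValue_le_jumpPrice_real {n m : ℝ} (hn5 : 5 ≤ n) (hm4 : 4 ≤ m) :
    n * (1 - Real.cos (π / n)) + m * (1 - Real.cos (π / m)) ≤ 2 * (1 + Real.cos (2 * π / n)) := by
  have h1 : n * (1 - Real.cos (π / n)) ≤ π ^ 2 / 10 := by
    have hc : 1 - (π / n) ^ 2 / 2 ≤ Real.cos (π / n) := Real.one_sub_sq_div_two_le_cos
    have e : n * ((π / n) ^ 2 / 2) = π ^ 2 / (2 * n) := by field_simp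
    calc n * (1 - Real.cos (π / n)) ≤ n * ((π / n) ^ 2 / 2) :=
          mul_le_mul_of_nonneg_left (by linarith) (by linarith)
      _ = π ^ 2 / (2 * n) := e
      _ ≤ π ^ 2 / 10 := div_le_div_of_nonneg_left (by positivity) (by norm_num) (by linarith)
  have h2 : m * (1 - Real.cos (π / m)) ≤ π ^ 2 / 8 := by
    have hc : 1 - (π / m) ^ 2 / 2 ≤ Real.cos (π / m) := Real.one_sub_sq_div_two_le_cos
    have e : m * ((π / m) ^ 2 / 2) = π ^ 2 / (2 * m) := by field_simp
    calc m * (1 - Real.cos (π / m)) ≤ m * ((π / m) ^ 2 / 2) :=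
          mul_le_mul_of_nonneg_left (by linarith) (by linarith)
      _ = π ^ 2 / (2 * m) := e
      _ ≤ π ^ 2 / 8 := div_le_div_of_nonneg_left (by positivity) (by norm_num) (by linarith)
  have h3 : 1 - (2 * π / n) ^ 2 / 2 ≤ Real.cos (2 * π / n) := Real.one_sub_sq_div_two_le_cos
  have h4 : 2 * π / n ≤ 2 * π / 5 := div_le_div_of_nonneg_left (by positivity) (by norm_num) hn5
  have h5 : (2 * π / n) ^ 2 ≤ (2 * π / 5) ^ 2 := by
    have : 0 ≤ 2 * π / n := by positivity
    nlinarith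
  have hπ : π ^ 2 < 9.9225 := by nlinarith [Real.pi_lt_d2, Real.pi_pos]
  nlinarith [h1, h2, h3, h5, hπ]

/-- The bookkeeping of the mountain pass (pure real arithmetic): the four signed tangent bounds,
the flux quantisation `σ + τ = 2πq` with `q ∉ (−1, 0)`, and `0 ≤ s₂ ≤ s₁`. [folklore] -/
theorem mountainPass_arith {N M c₁ c₂ s₁ s₂ σ τ q A₁ A₂ T : ℝ}
    (hs1 : 0 ≤ s₂) (hs2 : s₂ ≤ s₁) (hq : σ + τ = 2 * π * q) (hqZ : q ≤ -1 ∨ 0 ≤ q)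
    (B1 : N * c₁ + s₁ * (σ + π) ≤ A₁) (B2 : N * c₁ + s₁ * (-σ - π) ≤ A₂)
    (B3 : M * c₂ + s₂ * (τ - π) ≤ T) (B4 : M * c₂ + s₂ * (-τ - π) ≤ T) :
    N * c₁ + M * c₂ ≤ max (A₂ + T) (A₁ + T) := by
  have hπ := Real.pi_pos
  rcases hqZ with hq0 | hq0
  · have hπq : π * q ≤ -π := by nlinarith
    have hτ : σ + π ≤ -τ - π := by linarith
    rcases le_or_gt (σ + π) 0 with hu | hu
    · refine le_max_of_le_left ?_
      have f1 := mul_le_mul_of_nonneg_left hτ hs1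
      have f2 := mul_nonneg (sub_nonneg.2 hs2) (neg_nonneg.2 hu)
      nlinarith [f1, f2]
    · refine le_max_of_le_right ?_
      have f1 := mul_nonneg (hs1.trans hs2) hu.le
      have f2 := mul_nonneg hs1 (hu.le.trans hτ)
      nlinarith [f1, f2]
  · have hπq : 0 ≤ π * q := by nlinarith
    have hτ : -σ ≤ τ := by linarith
    rcases le_or_gt 0 (σ + π) with hu | hu
    · refine le_max_of_le_right ?_
      have f1 := mul_le_mul_of_nonneg_left hτ hs1
      have f2 := mul_nonneg (sub_nonneg.2 hs2) hu
      nlinarith [f1, f2]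
    · refine le_max_of_le_left ?_
      have f1 := mul_nonneg hs1 (show 0 ≤ τ - π by linarith)
      have f2 := mul_nonneg (hs1.trans hs2) (show 0 ≤ -σ - π by linarith)
      nlinarith [f1, f2]

end Arith

/-! ## §2 The generic mountain pass: an insertion carrying one unit of flux on `R` -/

section Generic

variable {L : ℕ} [NeZero L]

omit [NeZero L] in
/-- **Jump decomposition** for an insertion `W` with plaquette angles `a(x) ∈ [0, π)`:
`F_{WU}(x) = F_U(x) + a(x) + 2π m` with `m ∈ {0, −1}`. [folklore] -/
theorem exists_jump_mul (W U : GaugeConfig 2 L Circle) (a : Site 2 L → ℝ)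
    (hW : ∀ x, plaquetteHolonomy W x 0 1 = Circle.exp (a x)) (ha : ∀ x, 0 ≤ a x ∧ a x < π)
    (x : Site 2 L) : ∃ m : ℤ, (m = 0 ∨ m = -1) ∧
      abelianFieldTensor (W * U) x 0 1 = abelianFieldTensor U x 0 1 + a x + 2 * π * m := by
  have hexp : Circle.exp (abelianFieldTensor (W * U) x 0 1) =
      Circle.exp (abelianFieldTensor U x 0 1 + a x) := by
    rw [exp_abelianFieldTensor, plaquetteHolonomy_mul', hW, Circle.exp_add, exp_abelianFieldTensor,
      mul_comm]
  obtain ⟨m, hm⟩ := Circle.exp_eq_exp.mp hexp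
  refine ⟨m, ?_, by rw [hm]; ring⟩
  have h1 := neg_pi_lt_abelianFieldTensor (W * U) x 0 1
  have h2 := abelianFieldTensor_le_pi (W * U) x 0 1
  have h3 := neg_pi_lt_abelianFieldTensor U x 0 1
  have h4 := abelianFieldTensor_le_pi U x 0 1
  obtain ⟨h5, h6⟩ := ha x
  have hlt : (m : ℝ) < 1 := by nlinarith [Real.pi_pos]
  have hgt : (-2 : ℝ) < m := by nlinarith [Real.pi_pos]
  have hlt' : m < 1 := by exact_mod_cast hlt
  have hgt' : -2 < m := by exact_mod_cast hgt
  omega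

omit [NeZero L] in
/-- A jump costs `1 + cos α` when the inserted angle is at most `α ≤ π`. [folklore] -/
theorem one_add_cos_le_of_jump_mul {W U : GaugeConfig 2 L Circle} {a : Site 2 L → ℝ}
    {x : Site 2 L} {α : ℝ} (hax : a x ≤ α) (hαπ : α ≤ π)
    (h : abelianFieldTensor (W * U) x 0 1 = abelianFieldTensor U x 0 1 + a x + 2 * π * (-1 : ℤ)) :
    1 + Real.cos α ≤ 1 - Real.cos (abelianFieldTensor U x 0 1) := by
  have h1 := neg_pi_lt_abelianFieldTensor (W * U) x 0 1
  have h4 := abelianFieldTensor_le_pi U x 0 1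
  push_cast at h
  have hF : π - α ≤ abelianFieldTensor U x 0 1 := by linarith
  have hcos : Real.cos (abelianFieldTensor U x 0 1) ≤ Real.cos (π - α) :=
    Real.cos_le_cos_of_nonneg_of_le_pi (by linarith) h4 hF
  rw [Real.cos_pi_sub] at hcos
  linarith

/-- **Charge change**: `Q(WU) = Q(U) + Σ_x a(x)/(2π) + Σ_x m(x)`. [folklore] -/
theorem topCharge_mul_eq_of_jumps (W U : GaugeConfig 2 L Circle) (a : Site 2 L → ℝ)
    (m : Site 2 L → ℤ) (hm : ∀ x, abelianFieldTensor (W * U) x 0 1 =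
      abelianFieldTensor U x 0 1 + a x + 2 * π * m x) :
    topCharge (0 : Site 2 L) 0 1 (W * U) =
      topCharge (0 : Site 2 L) 0 1 U + (∑ x : Site 2 L, a x) / (2 * π) +
        ∑ x : Site 2 L, (m x : ℝ) := by
  have hπ : (2 : ℝ) * π ≠ 0 := by positivity
  have h1 := two_pi_mul_topCharge_eq_sum_site (W * U)
  have h2 := two_pi_mul_topCharge_eq_sum_site U
  simp only [hm, Finset.sum_add_distrib, ← Finset.mul_sum] at h1
  apply mul_left_cancel₀ hπ
  rw [h1, mul_add, mul_add, h2, mul_div_cancel₀ _ hπ]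

/-- **THE GENERIC MOUNTAIN-PASS INEQUALITY.**  Let the insertion `W` carry plaquette angle `α > 0`
on the `N` positions of `R` and `0` elsewhere, `Nα = 2π`, `5 ≤ N ≤ M = #Rᶜ`.  Then for EVERY
configuration `U` with `Q(WU) ≠ Q(U)`: `max(S(U), S(WU)) ≥ N(1 − cos(α/2)) + M(1 − cos(π/M))`.
[folklore] -/
theorem sharpValue_le_max_wilsonAction_of_exp (W U : GaugeConfig 2 L Circle)
    (R : Finset (Site 2 L)) {α : ℝ}
    (hW : ∀ x, plaquetteHolonomy W x 0 1 = Circle.exp (if x ∈ R then α else 0))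
    (hα0 : 0 < α) (hNα : (R.card : ℝ) * α = 2 * π) (hN5 : 5 ≤ R.card) (hNM : R.card ≤ Rᶜ.card)
    (hne : topCharge (0 : Site 2 L) 0 1 (W * U) ≠ topCharge (0 : Site 2 L) 0 1 U) :
    (R.card : ℝ) * (1 - Real.cos (α / 2)) +
        (Rᶜ.card : ℝ) * (1 - Real.cos (π / (Rᶜ.card : ℝ))) ≤
      max (wilsonAction u1Rep U) (wilsonAction u1Rep (W * U)) := by
  classical
  obtain ⟨n, hn⟩ : ∃ n : ℝ, (R.card : ℝ) = n := ⟨_, rfl⟩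
  obtain ⟨mM, hmM⟩ : ∃ mM : ℝ, (Rᶜ.card : ℝ) = mM := ⟨_, rfl⟩
  have hn5 : (5 : ℝ) ≤ n := by rw [← hn]; exact_mod_cast hN5
  have hnm : n ≤ mM := by rw [← hn, ← hmM]; exact_mod_cast hNM
  have hm5 : 5 ≤ mM := hn5.trans hnm
  rw [hn, hmM]
  have hnα : n * α = 2 * π := by rw [← hn]; exact hNα
  have hα : α = 2 * π / n := by
    rw [eq_div_iff (by linarith : n ≠ 0)]; linarith
  have hα5 : α ≤ 2 * π / 5 := by
    rw [hα]; exact div_le_div_of_nonneg_left (by positivity) (by norm_num) hn5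
  have hαπ : α < π := by nlinarith [Real.pi_pos]
  set a : Site 2 L → ℝ := fun x => if x ∈ R then α else 0 with ha_def
  have ha : ∀ x, 0 ≤ a x ∧ a x < π := by
    intro x; simp only [ha_def]; split_ifs <;> constructor <;> linarith [Real.pi_pos]
  have haα : ∀ x, a x ≤ α := by
    intro x; simp only [ha_def]; split_ifs <;> linarith
  have hj := fun x => exists_jump_mul W U a hW ha x
  choose m hm01 hm using hj
  have hsuma : ∑ x : Site 2 L, a x = 2 * π := by
    rw [← Finset.sum_add_sum_compl R]
    rw [Finset.sum_congr rfl fun x (hx : x ∈ R) => show a x = α from if_pos hx,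
      Finset.sum_eq_zero fun x (hx : x ∈ Rᶜ) => show a x = 0 from if_neg (Finset.mem_compl.mp hx),
      Finset.sum_const, nsmul_eq_mul, add_zero, hNα]
  have hQ := topCharge_mul_eq_of_jumps W U a m hm
  rw [hsuma, div_self (by positivity : (2 : ℝ) * π ≠ 0)] at hQ
  -- the sum of the jumps is an integer `≠ -1`, each jump is `0` or `-1`
  have hsum_ne : (∑ x : Site 2 L, m x) ≠ -1 := by
    intro h
    have h' : (∑ x : Site 2 L, (m x : ℝ)) = -1 := by exact_mod_cast h
    rw [h'] at hQ
    exact hne (by rw [hQ]; ring)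
  by_cases hall : ∀ x, m x = 0
  · -- no jump: the angles add
    have hF' : ∀ x : Site 2 L, abelianFieldTensor (W * U) x 0 1 =
        abelianFieldTensor U x 0 1 + a x := by
      intro x; rw [hm x, hall x]; simp
    set F : Site 2 L → ℝ := fun x => abelianFieldTensor U x 0 1 with hF
    have hFb : ∀ x, -π ≤ F x ∧ F x ≤ π :=
      fun x => ⟨(neg_pi_lt_abelianFieldTensor U x 0 1).le, abelianFieldTensor_le_pi U x 0 1⟩
    -- the two actions, split over `R` and `Rᶜ`
    have hSU : wilsonAction u1Rep U =
        ∑ x ∈ R, (1 - Real.cos (F x)) + ∑ x ∈ Rᶜ, (1 - Real.cos (F x)) := by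
      rw [wilsonAction_eq_sum_site, ← Finset.sum_add_sum_compl R]
    have hSW : wilsonAction u1Rep (W * U) =
        ∑ x ∈ R, (1 - Real.cos (F x + α)) + ∑ x ∈ Rᶜ, (1 - Real.cos (F x)) := by
      rw [wilsonAction_eq_sum_site, ← Finset.sum_add_sum_compl R]
      congr 1
      · refine Finset.sum_congr rfl fun x hx => ?_
        rw [hF', show a x = α from if_pos hx]
      · refine Finset.sum_congr rfl fun x hx => ?_
        rw [hF', show a x = 0 from if_neg (Finset.mem_compl.mp hx), add_zero]
    -- flux quantisation
    obtain ⟨q, hq⟩ := exists_int_sum_site_eq U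
    rw [← Finset.sum_add_sum_compl R] at hq
    set σ := ∑ x ∈ R, F x with hσ
    set τ := ∑ x ∈ Rᶜ, F x with hτ
    -- the tangent bounds
    have hα2 : α / 2 = π / n := by rw [hα]; ring
    have hc1 : 0 ≤ α / 2 := by linarith
    have hc1' : α / 2 ≤ 7 / 10 := by
      rw [hα2, div_le_iff₀ (by linarith)]; nlinarith [Real.pi_lt_d2]
    have hc2 : 0 ≤ π / mM := by positivity
    have hc2' : π / mM ≤ 7 / 10 := by
      rw [div_le_iff₀ (by linarith)]; nlinarith [Real.pi_lt_d2]
    have B1 := sum_tangent_le R (fun x => F x + α) hc1 hc1' (fun x hx => by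
      have h1 := neg_pi_lt_abelianFieldTensor (W * U) x 0 1
      have h2 := abelianFieldTensor_le_pi (W * U) x 0 1
      rw [hF', show a x = α from if_pos hx] at h1 h2
      exact ⟨h1.le, h2⟩)
    have B2 := sum_tangent_le_neg R F hc1 hc1' (fun x _ => hFb x)
    have B3 := sum_tangent_le Rᶜ F hc2 hc2' (fun x _ => hFb x)
    have B4 := sum_tangent_le_neg Rᶜ F hc2 hc2' (fun x _ => hFb x)
    simp only [Finset.sum_add_distrib, Finset.sum_const, nsmul_eq_mul] at B1
    rw [hn] at B1 B2
    rw [hmM] at B3 B4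
    have e1 : mM * (π / mM) = π := by field_simp
    rw [e1] at B3 B4
    have hsin1 : 0 ≤ Real.sin (π / mM) :=
      Real.sin_nonneg_of_nonneg_of_le_pi hc2 (by linarith [Real.pi_gt_three])
    have hsin2 : Real.sin (π / mM) ≤ Real.sin (α / 2) := by
      rw [hα2]
      exact Real.sin_le_sin_of_le_of_le_pi_div_two (by linarith [Real.pi_pos])
        (by rw [div_le_iff₀ (by linarith)]; nlinarith [Real.pi_pos])
        (div_le_div_of_nonneg_left Real.pi_pos.le (by linarith) hnm)
    have e2 : σ + n * α - n * (α / 2) = σ + π := by linarith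
    have e3 : -σ - n * (α / 2) = -σ - π := by linarith
    rw [e2] at B1
    rw [e3] at B2
    have hqZ : (q : ℝ) ≤ -1 ∨ 0 ≤ (q : ℝ) := by
      rcases le_or_gt 0 q with h | h
      · exact Or.inr (by exact_mod_cast h)
      · exact Or.inl (by exact_mod_cast (show q ≤ -1 by omega))
    rw [hSU, hSW]
    exact mountainPass_arith hsin1 hsin2 hq hqZ B1 B2 B3 B4
  · -- a jump: `Σ m ≤ -2`, and each jump costs `1 + cos α`
    push Not at hall
    obtain ⟨x₀, hx₀⟩ := hall
    have hx₀' : m x₀ = -1 := (hm01 x₀).resolve_left hx₀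
    have hle0 : ∀ x, m x ≤ 0 := fun x => by rcases hm01 x with h | h <;> omega
    have hsum2 : (∑ x : Site 2 L, m x) ≤ -2 := by
      have h1 : (∑ x : Site 2 L, m x) = m x₀ + ∑ x ∈ Finset.univ.erase x₀, m x :=
        (Finset.add_sum_erase Finset.univ m (Finset.mem_univ x₀)).symm
      have h2 : ∑ x ∈ Finset.univ.erase x₀, m x ≤ 0 := Finset.sum_nonpos fun x _ => hle0 x
      omega
    have hterm : ∀ x : Site 2 L, -(m x : ℝ) * (1 + Real.cos α) ≤
        1 - Real.cos (abelianFieldTensor U x 0 1) := by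
      intro x
      rcases hm01 x with h0 | h1
      · rw [h0, Int.cast_zero, neg_zero, zero_mul]
        linarith [Real.cos_le_one (abelianFieldTensor U x 0 1)]
      · have hx := hm x
        rw [h1] at hx
        rw [h1, Int.cast_neg, Int.cast_one, neg_neg, one_mul]
        exact one_add_cos_le_of_jump_mul (haα x) hαπ.le hx
    have hS : 2 * (1 + Real.cos α) ≤ wilsonAction u1Rep U := by
      rw [wilsonAction_eq_sum_site]
      refine le_trans ?_ (Finset.sum_le_sum fun x _ => hterm x)
      rw [← Finset.sum_mul, Finset.sum_neg_distrib]
      have h2 : (2 : ℝ) ≤ -∑ x : Site 2 L, (m x : ℝ) := by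
        have : ((∑ x : Site 2 L, m x : ℤ) : ℝ) ≤ -2 := by exact_mod_cast hsum2
        push_cast at this
        linarith
      have hc : 0 ≤ 1 + Real.cos α := by linarith [Real.neg_one_le_cos α]
      nlinarith [mul_le_mul_of_nonneg_right h2 hc]
    have hm4 : 4 ≤ mM := by linarith
    have hj := sharpValue_le_jumpPrice_real hn5 hm4
    rw [← hα] at hj
    have hα2 : α / 2 = π / n := by rw [hα]; ring
    rw [hα2]
    exact le_max_of_le_left (hj.trans hS)

end Generic

end Summit.Ventures.LatticeQCDFlow.Theory2.Lattice.Flux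

end
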